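import Summits.PneNP.PneNP.Theorems.OracleRefusal.Negative.StaInvChainRuns

/-!
# `OracleRefusal` (stmt-PneNP-1864) — negative side, II: Semantic inversion, part 8 (§B.9): existence of the CANONICAL run of a chain for every choice of chain values `qs` and of
letter axiom labels `as` (`chain_exists`).
-/

namespace Summit.PneNP.PneNP.Theorems.OracleRefusal.Negative

open Literature.Computability.ImplicitComplexity
open Literature.Computability.ImplicitComplexity.URel
open Literature.Computability.ImplicitComplexity.STA (Deriv Ctx Term LinTy SoftTy encWord encBit tyS tyB tyF mpxRen
  liftRen)

/-! ## §B.9 The canonical run of a chain -/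

/-- Canonical letter labels: one copy of the letter point with the chosen axiom label `as j` at position `j`.
[folklore] -/
noncomputable def canonP (bs : List Bool) (as : ℕ → Point) (j : ℕ) : Point := bang1 (bitPtAt (bs.getD j false) (as j))

/-- Canonical rest labels: one copy of the next chain value. [folklore] -/
noncomputable def canonR (qs : ℕ → Point) (j : ℕ) : Point := bang1 (qs (j + 1))

/-- A sequence is its head consed onto its tail. [folklore] -/
theorem consF_self (qs : ℕ → Point) : consF (qs 0) (fun j => qs (j + 1)) = qs := by
  funext j; cases j <;> rfl

/-- Canonical letter labels of a longer word. [folklore] -/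
theorem consF_canonP (b : Bool) (bs : List Bool) (as : ℕ → Point) :
    consF (bang1 (bitPtAt b (as 0))) (canonP bs fun j => as (j + 1)) = canonP (b :: bs) as := by
  funext j; cases j <;> rfl

/-- Canonical rest labels, shifted. [folklore] -/
theorem consF_canonR (qs : ℕ → Point) :
    consF (bang1 (qs 1)) (canonR fun j => qs (j + 1)) = canonR qs := by
  funext j; cases j <;> rfl

/-- With canonical rest labels the tail alternative "discarded" is impossible: the tail slot is wrapped around the
last chain value. [folklore] -/
theorem ChainTail.canon {Γ : Ctx} {ρ : Val} {z n J : ℕ} {qs : ℕ → Point} (h : ChainTail Γ ρ z n J qs (canonR qs)) :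
    SlotIn (fun k => Wrap k (bang1 (qs n))) Γ ρ z := by
  rcases h with ⟨-, -, h3⟩ | ⟨_, h2, -⟩
  · exact h3
  · exact absurd h2 (bang1_ne_bang0 _)

/-- **Existence of the canonical run of a chain**: every derivation of a chain has, for every choice of chain values
`qs`, a run with result `qs 0` in which every position is evaluated, every letter taken once at its canonical point,
every rest taken once, and the tail used once at `qs |bs|`. [cite: LaurentTortoraDeFalco2006, Def. 12] -/
theorem chain_exists : {d : ℕ} → {Γ : Ctx} → {M : Term} → {σ : SoftTy} → (D : Deriv d Γ M σ) → {z : ℕ} →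
    {bs : List Bool} → {hs : List ℕ} → IsChain z M bs hs → σ.bangs = 0 → z ∉ hs →
    (∀ c ∈ hs, ∃ k K, Γ c = some ⟨k, K⟩ ∧ KernelOK K) →
      ∀ as qs : ℕ → Point, ∃ ρ : Val, (ρ, qs 0) ∈ D.interp ∧
        HeadsDesc Γ ρ hs {z} bs.length qs (canonP bs as) (canonR qs) ∧
          ChainTail Γ ρ z bs.length bs.length qs (canonR qs)
  | _, _, _, _, .ax h, z, bs, hs, hC, _, _, _, as, qs => by
      obtain ⟨rfl, rfl, rfl⟩ := hC.var_inv
      obtain ⟨ρ, hr⟩ := var_exists (.ax h) rfl rfl (qs 0)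
      have hV := var_runs (.ax h) rfl rfl hr
      exact ⟨ρ, hr, ⟨fun s hs => by simp at hs, fun s _ hsz => hV.2.2 s hsz, fun j hj => by simp at hj⟩,
        Or.inl ⟨rfl, fun j hj => by simp at hj, hV.2.1⟩⟩
  | _, _, _, _, .weak (Γ := Γ) j A h hj hΓ', z, bs, hs, hC, hσ, hzh, hK, as, qs => by
      obtain ⟨⟨τ, hτ⟩, hhp⟩ := chain_present h hC
      have hzj : z ≠ j := fun e => by rw [e, hj] at hτ; cases hτ
      have hK' : ∀ c ∈ hs, ∃ k K, Γ c = some ⟨k, K⟩ ∧ KernelOK K := fun c hc => by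
        obtain ⟨k, K, hΓc, hKc⟩ := hK c hc
        obtain ⟨τ', hτ'⟩ := hhp c hc
        have hcj : c ≠ j := fun e => by rw [e, hj] at hτ'; cases hτ'
        rw [hΓ', Function.update_of_ne hcj] at hΓc
        exact ⟨k, K, hΓc, hKc⟩
      obtain ⟨ρ, hm, hH, hT⟩ := chain_exists h hC hσ hzh hK' as qs
      subst hΓ'
      exact ⟨_, ⟨ρ, _, hm, rfl⟩, hH.weak hj A, hT.weak hzj _ _⟩
  | _, _, _, _, .lam _, _, _, _, hC, _, _, _, _, _ => hC.lam_inv.elim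
  | _, _, _, _, .app (Γ := Γ) (Γ₁ := Γ₁) (Γ₂ := Γ₂) (k := k) (B := B) (A := A) hs h₁ h₂, z, bs, hds, hC, _, hzh, hK,
      as, qs => by
      obtain ⟨c, b, bs', hs', hM₁, rfl, rfl, hC'⟩ := hC.app_inv
      obtain ⟨⟨τz, hτz⟩, hhp'⟩ := chain_present h₂ hC'
      obtain ⟨τc, hτc⟩ := app1_present h₁ hM₁
      have hΓ₁c : Γ₁ c = Γ c := by
        rcases hs c with ⟨h1, -⟩ | ⟨h1, -⟩
        · exact h1
        · rw [h1] at hτc; cases hτc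
      have hΓ₂z : Γ₂ z = Γ z := by
        rcases hs z with ⟨-, h2⟩ | ⟨-, h2⟩
        · rw [h2] at hτz; cases hτz
        · exact h2
      have hΓ₁z : Γ₁ z = none := by
        rcases hs z with ⟨-, h2⟩ | ⟨h1, -⟩
        · rw [h2] at hτz; cases hτz
        · exact h1
      have hΓ₂h : ∀ s ∈ hs', Γ₂ s = Γ s ∧ Γ₁ s = none := fun s hs' => by
        obtain ⟨τ', hτ'⟩ := hhp' s hs'
        rcases hs s with ⟨-, h2⟩ | ⟨h1, h2⟩
        · rw [h2] at hτ'; cases hτ'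
        · exact ⟨h2, h1⟩
      have hzc : z ≠ c := fun e => hzh (e ▸ List.mem_cons_self ..)
      have hzh' : z ∉ hs' := fun h => hzh (List.mem_cons_of_mem _ h)
      obtain ⟨k₀, K, hΓc, hKc⟩ := hK c (List.mem_cons_self ..)
      rw [← hΓ₁c] at hΓc
      rcases hKc.cases with ⟨n, rfl⟩ | ⟨B₁, A₁, rfl, hB₁, hA₁⟩
      · obtain ⟨_, _, _, h, -⟩ := app1_ty h₁ hM₁ rfl hΓc rfl
        cases h
      · have hpA : peel A₁ = A₁ := by rcases hA₁ with ⟨n, rfl⟩ | ⟨A₂, A₃, rfl⟩ <;> rfl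
        obtain ⟨k₁, B₁', A₁', hK₁, hj⟩ := app1_ty h₁ hM₁ rfl hΓc rfl
        simp only [LinTy.limp.injEq] at hK₁
        obtain ⟨rfl, rfl, rfl⟩ := hK₁
        obtain ⟨j, hj⟩ := hj hpA
        have hk : k = 0 := by
          rcases j with _ | j
          · change LinTy.limp k B A = A₁.rename (· + 0) at hj
            rcases hA₁ with ⟨n, rfl⟩ | ⟨A₂, A₃, rfl⟩
            · cases hj
            · simp only [STA.LinTy.rename, LinTy.limp.injEq] at hj
              exact hj.1
          · change LinTy.limp k B A = LinTy.all _ at hj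
            cases hj
        have hK' : ∀ c' ∈ hs', ∃ k K, Γ₂ c' = some ⟨k, K⟩ ∧ KernelOK K := fun c' hc' => by
          obtain ⟨k', K', hΓc', hKc'⟩ := hK c' (List.mem_cons_of_mem _ hc')
          exact ⟨k', K', by rw [(hΓ₂h c' hc').1]; exact hΓc', hKc'⟩
        -- the canonical run of the rest, one copy of it, and the head run on top
        obtain ⟨ρ₂, hr₂, hH', hT'⟩ := chain_exists h₂ hC' hk hzh' hK' (fun j => as (j + 1)) fun j => qs (j + 1)
        obtain ⟨ρ₁, hm₁, hV₁⟩ := app1_exists h₁ hM₁ rfl hΓc hB₁ (as 0) ((bang1 (qs 1)).dual.par (qs 0))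
        have hsome₁ : ∀ s, (ρ₁ s).isSome = (Γ₁ s).isSome := h₁.isSome_of_mem_interp hm₁
        refine ⟨Val.merge ρ₁ ρ₂, ⟨ρ₁, ρ₂, bang1 (qs 1), qs 0, hm₁, mem_liftArg_one hk hr₂, rfl⟩, ?_⟩
        have step := chain_app_step (qs' := fun j => qs (j + 1)) (P' := canonP bs' fun j => as (j + 1))
          (R' := canonR fun j => qs (j + 1)) (Pb := bang1 (bitPtAt b (as 0))) (q := qs 0) hs hΓ₁c hΓ₂z hΓ₁z hΓ₂h
          hV₁ hsome₁ hH' hT' hzc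
        rw [consF_self, consF_canonP, consF_canonR] at step
        simpa using step
  | _, _, _, _, .mpx (Γ := Γ) (σ := τ₀) S j h hS hj hΓ' hM', z, bs, hs, hC, hσ, hzh, hK, as, qs => by
      rw [hM'] at hC
      obtain ⟨z₀, hs₀, hC₀, hz₀, hhs⟩ := hC.of_rename rfl
      obtain ⟨⟨τ, hτ⟩, hhp⟩ := chain_present h hC₀
      have hjS : j ∉ S := fun hj' => by simpa [hj] using hS j hj'
      subst hz₀; subst hhs
      have hzh₀ : z₀ ∉ hs₀ := fun hm => hzh (List.mem_map.2 ⟨z₀, hm, rfl⟩)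
      have hK₀ : ∀ c ∈ hs₀, ∃ k K, Γ c = some ⟨k, K⟩ ∧ KernelOK K := by
        intro c₀ hc₀
        obtain ⟨k, K, hΓc, hKc⟩ := hK _ (List.mem_map.2 ⟨c₀, hc₀, rfl⟩)
        obtain ⟨τ', hτ'⟩ := hhp c₀ hc₀
        have hcj : c₀ ≠ j := fun e => by rw [e, hj] at hτ'; cases hτ'
        rw [hΓ'] at hΓc
        by_cases hcS : c₀ ∈ S
        · simp only [mpxRen, hcS, if_true, Ctx.mpx, hjS, if_false, Option.some.injEq] at hΓc
          refine ⟨τ₀.bangs, K, ?_, hKc⟩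
          rw [hS c₀ hcS, ← show τ₀.lin = K from congrArg SoftTy.lin hΓc]
        · simp only [mpxRen, hcS, if_false, Ctx.mpx, hcj] at hΓc
          exact ⟨k, K, hΓc, hKc⟩
      obtain ⟨ρ, hm, hH, hT⟩ := chain_exists h hC₀ hσ hzh₀ hK₀ as qs
      subst hΓ'
      obtain ⟨hH', hT'⟩ := chainInv_mpx hH hT hS hj hzh ⟨τ, hτ⟩ hhp
      exact ⟨_, ⟨ρ, _, hm, rfl⟩, hH', hT'⟩
  | _, _, _, _, .sp _ _, _, _, _, _, hσ, _, _, _, _ => by simp at hσ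
  | _, _, _, _, .allI (Γ := Γ) h hΔ, z, bs, hs, hC, _, hzh, hK, as, qs => by
      have hK' : ∀ c ∈ hs, ∃ k K, Γ.shift c = some ⟨k, K⟩ ∧ KernelOK K := fun c hc => by
        obtain ⟨k, K, hΓc, hKc⟩ := hK c hc
        exact ⟨k, K.rename Nat.succ, by simp [Ctx.shift, hΓc]; rfl, hKc.rename_succ⟩
      rw [← hΔ] at hK'
      obtain ⟨ρ, hm, hH, hT⟩ := chain_exists h hC rfl hzh hK' as qs
      rw [hΔ] at hH hT
      exact ⟨ρ, hm, hH.of_shift, hT.of_shift⟩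
  | _, _, _, _, .allE _ h, _, _, _, hC, _, hzh, hK, as, qs => chain_exists h hC rfl hzh hK as qs
  | _, _, _, _, .sum _ _, _, _, _, hC, _, _, _, _, _ => hC.sum_inv.elim

end Summit.PneNP.PneNP.Theorems.OracleRefusal.Negative
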